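import Literature.Barriers.ABC.NConjectureExponentSharp
import HarnessLib

/-!
# Hölzl–Kleine–Stephan, Theorem 13: `Q_{R(n)} ≥ 5/4` for `n ≥ 6` (discharge of `PairwiseQualityFloor`)

`Literature/Barriers/ABC/NConjectureExponentSharpProofs.lean` — sibling proof file of the barrier
record `NConjectureExponentSharp.lean`. It discharges the named fact
`Literature.Barriers.ABC.PairwiseQualityFloor` ("for every `n ≥ 6` and every `θ < 5/4` there are
infinitely many pairwise coprime admissible `n`-term sums of quality `> θ`"), i.e. Theorem 13 of
Hölzl–Kleine–Stephan, *Improved lower bounds for strong `n`-conjectures*, J. Aust. Math. Soc. (2025),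
arXiv:2409.13439, in its `R(n)` form ("In particular, `Q_{R(n)} ≥ 5/4` for each `n ≥ 6`").

## What the source prints (verified in the held text of arXiv:2409.13439, §1 and §3)

Theorem 13: "Let `n ≥ 6` and let `F` be an arbitrary finite set. Then `Q_{U(F,n)} ≥ 5/4`. In
particular, `Q_{R(n)} ≥ 5/4` for each `n ≥ 6`." Proof: `F = {3, …, ℓ}`, `s = ℓ!`, `y = s·t`,
`x = (y+1)^{h!}`; `a₁ = (x+y)⁵`, `a₂ = −(x−y)⁵`, `a₃ = −(10y−1)x⁴`, `a₄ = −(x²+10y³)²`, so that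
`a₁ + a₂ + a₃ + a₄ = 2y⁵ − 100y⁶` (‡) is independent of `x`; `a₇, …, aₙ` negated odd primes with
`|a₇| > 200y⁶`, `|a_{k+1}| > 2|a_k|`; `a₅, a₆ = v, w` from the factor-avoidance Lemma 15 applied to
`u = −(a₁+⋯+a₄+a₇+⋯+aₙ)`; Lemma 18 (`gcd(y±1, 10y−1) = gcd(y+1, 10y+1) = 1`) and Fermat's little
theorem (`x ≡ 1` modulo every relevant prime) give pairwise coprimality; the subsum condition is
checked by size comparisons; "`rad(a₁⋯aₙ)` is bounded from above by a polynomial in `x` of degree at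
most `4`, while … `max{|a₁|,…,|aₙ|}` is bounded from below by a polynomial in `x` of degree `5`.
Therefore `Q_{U(F,n)} ≥ 5/4`." [cite: HolzlKleineStephan2025, Theorem 13]

## Lean rendering (same skeleton; choices made for the formalisation)

The Lean statement only concerns Ramaekers' class `R(n)` (`F = ∅`, `{0,1}`-subsums), so we fix
`y = 330 = 2·3·5·11` (then every residue side condition of Lemma 18 and of the coprimality steps is a
numerical `gcd` computation: `gcd(331, 3299) = gcd(329, 3299) = gcd(331, 3301) = gcd(329, 3301) =
gcd(3299, 1 + 10·330³) = gcd(331, 10) = 1`) and take `x = 331^{φ(L)(t + T₀)}` where `L` is the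
product of `10y ± 1` and all constant entries: Euler's theorem `331^{φ(L)} ≡ 1 (mod L)` replaces
`x = (y+1)^{h!}` + Fermat. The fillers `a₇, …, aₙ` are `−q_j` with `q_j = 2P_j + 1`, `P₀ = B`,
`P_{j+1} = P_j q_j` (`B = (y+1)(y−1)(10y−1)(10y³+1)`): odd, pairwise coprime and coprime to `B` by
Euclid's trick — no primes needed (`eucQ`). Lemma 15 is replaced by the splitting lemma
`exists_odd_forall_not_dvd` (given finitely many odd primes `S` and `u`, some odd `r ≥ K` has
`p ∤ r`, `p ∤ u − r` for all `p ∈ S`; induction on `S` with three candidates `r₀ + k·2P` and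
pigeonhole), applied to the odd primes of `B · ∏ q_j · u`; `a₅ = v = r > u`, `a₆ = w = u − v < 0`.
Pairwise coprimality of `a₁, …, a₄` is `IsCoprime` algebra (`isCoprime_A1_A2`, …, `isCoprime_A3_A4`,
e.g. `x² + 10y³ = (x+y)(x−y) + y²(10y+1)`), cross coprimality is `isCoprime_cross`. The subsum
condition (for `{0,1}`-coefficients) follows from the sign pattern alone (`sum_ne_zero_of_pattern`:
positives `a₁, a₅`; `|a₂|, |a₃|, |a₄| > a₅ > |a₆| + ∑ q_j − c`). Every entry divides a power of
`D = (x+y)(x−y)(10y−1)·331^{φ(L)}·(x²+10y³)·v·(−w)·∏ q_j ≤ K x⁴` (`radical_le`), `max |aᵢ| ≥ x⁵`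
(`pow_five_le_tupleMax`), and `5t log b / (log K + 4t log b) → 5/4`
(`nQuality_eventually_gt_five_fourths`). The tuple is built on `Fin m ⊕ Fin 6` (`hksFun`) and
transported to `Fin (m + 6)` along `finSumFinEquiv` (`HKSData.hksTuple`).

Nothing here changes the statements of `NConjectureExponentSharp.lean`; no new named facts.
-/

noncomputable section

open Finset UniqueFactorizationMonoid

namespace Literature.Barriers.ABC

/-! ### Step 1: coprime splitting `u = v + w` avoiding a finite set of odd primes -/

/-- Splitting lemma (our replacement for the factor-avoidance Lemma 15 of Hölzl–Kleine–Stephan):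
given finitely many odd primes `S`, an integer `u` and a bound `K`, there is an odd `r ≥ K` such that
no `p ∈ S` divides `r` or `u − r`. Proof: induction on `S`, three candidates `r₀ + k·2P` and
pigeonhole. [folklore] -/
theorem exists_odd_forall_not_dvd (u K : ℤ) (S : Finset ℕ) (hS : ∀ p ∈ S, p.Prime ∧ p ≠ 2) :
    ∃ r : ℤ, K ≤ r ∧ Odd r ∧ ∀ p ∈ S, ¬ ((p : ℤ) ∣ r) ∧ ¬ ((p : ℤ) ∣ u - r) := by
  classical
  induction S using Finset.induction_on with
  | empty =>
    refine ⟨2 * |K| + 1, ?_, ⟨|K|, rfl⟩, fun p hp => absurd hp (Finset.notMem_empty p)⟩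
    have := le_abs_self K
    have := abs_nonneg K
    linarith
  | @insert p S hpS ih =>
    obtain ⟨r₀, hK₀, hodd₀, hr₀⟩ := ih fun q hq => hS q (Finset.mem_insert_of_mem hq)
    obtain ⟨hp, hp2⟩ := hS p (Finset.mem_insert_self p S)
    set P : ℤ := ∏ q ∈ S, (q : ℤ) with hPdef
    have hP : 0 < P := by
      rw [hPdef]
      exact Finset.prod_pos fun q hq => by
        exact_mod_cast (hS q (Finset.mem_insert_of_mem hq)).1.pos
    have hpi : Prime (p : ℤ) := Nat.prime_iff_prime_int.mp hp
    have hp3 : (3 : ℤ) ≤ p := by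
      have h2 := hp.two_le
      have : p ≠ 2 := hp2
      omega
    -- `p ∤ 2P`
    have hpP : ¬ ((p : ℤ) ∣ 2 * P) := by
      intro h
      rcases hpi.dvd_or_dvd h with h2 | hP'
      · have := Int.le_of_dvd (by norm_num) h2
        omega
      · rw [hPdef] at hP'
        obtain ⟨q, hq, hpq⟩ := (Prime.dvd_finsetProd_iff hpi _).mp hP'
        have hpq' : p ∣ q := by exact_mod_cast hpq
        have := (Nat.prime_dvd_prime_iff_eq hp (hS q (Finset.mem_insert_of_mem hq)).1).mp hpq'
        exact hpS (this ▸ hq)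
    -- differences of candidates are not divisible by `p`
    have hkey : ∀ i j : ℤ, i < j → j ≤ i + 2 → ¬ ((p : ℤ) ∣ (j - i) * (2 * P)) := by
      intro i j hij hji h
      rcases hpi.dvd_or_dvd h with h1 | h1
      · have := Int.le_of_dvd (by omega) h1
        omega
      · exact hpP h1
    -- one of the three candidates works
    have hcand : ∃ k : ℤ, 0 ≤ k ∧ ¬ ((p : ℤ) ∣ r₀ + k * (2 * P)) ∧
        ¬ ((p : ℤ) ∣ u - (r₀ + k * (2 * P))) := by
      by_contra hcon
      push Not at hcon
      have hA : ∀ i j : ℤ, i < j → j ≤ i + 2 → (p : ℤ) ∣ r₀ + i * (2 * P) →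
          (p : ℤ) ∣ r₀ + j * (2 * P) → False := by
        intro i j hij hji hi hj
        refine hkey i j hij hji ?_
        have e : r₀ + j * (2 * P) - (r₀ + i * (2 * P)) = (j - i) * (2 * P) := by ring
        exact e ▸ dvd_sub hj hi
      have hB : ∀ i j : ℤ, i < j → j ≤ i + 2 → (p : ℤ) ∣ u - (r₀ + i * (2 * P)) →
          (p : ℤ) ∣ u - (r₀ + j * (2 * P)) → False := by
        intro i j hij hji hi hj
        refine hkey i j hij hji ?_
        have e : u - (r₀ + i * (2 * P)) - (u - (r₀ + j * (2 * P))) = (j - i) * (2 * P) := by ring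
        exact e ▸ dvd_sub hi hj
      have h0 := hcon 0 le_rfl
      have h1 := hcon 1 (by norm_num)
      have h2 := hcon 2 (by norm_num)
      by_cases a0 : (p : ℤ) ∣ r₀ + 0 * (2 * P)
      · by_cases a1 : (p : ℤ) ∣ r₀ + 1 * (2 * P)
        · exact hA 0 1 (by norm_num) (by norm_num) a0 a1
        · by_cases a2 : (p : ℤ) ∣ r₀ + 2 * (2 * P)
          · exact hA 0 2 (by norm_num) (by norm_num) a0 a2
          · exact hB 1 2 (by norm_num) (by norm_num) (h1 a1) (h2 a2)
      · by_cases a1 : (p : ℤ) ∣ r₀ + 1 * (2 * P)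
        · by_cases a2 : (p : ℤ) ∣ r₀ + 2 * (2 * P)
          · exact hA 1 2 (by norm_num) (by norm_num) a1 a2
          · exact hB 0 2 (by norm_num) (by norm_num) (h0 a0) (h2 a2)
        · exact hB 0 1 (by norm_num) (by norm_num) (h0 a0) (h1 a1)
    obtain ⟨k, hk0, hk1, hk2⟩ := hcand
    refine ⟨r₀ + k * (2 * P), ?_, ?_, ?_⟩
    · nlinarith
    · exact hodd₀.add_even ⟨k * P, by ring⟩
    · intro q hq
      rcases Finset.mem_insert.mp hq with rfl | hq
      · exact ⟨hk1, hk2⟩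
      · have hqP : (q : ℤ) ∣ k * (2 * P) := by
          rw [hPdef]
          exact Dvd.dvd.mul_left (Dvd.dvd.mul_left (Finset.dvd_prod_of_mem _ hq) _) _
        obtain ⟨h1, h2⟩ := hr₀ q hq
        refine ⟨fun h => h1 ((dvd_add_left hqP).mp h), fun h => h2 ?_⟩
        have : u - r₀ = (u - (r₀ + k * (2 * P))) + k * (2 * P) := by ring
        rw [this]
        exact dvd_add h hqP

/-- From "no prime divides both" to `IsCoprime` in `ℤ`. [folklore] -/
theorem isCoprime_of_forall_prime {a b : ℤ}
    (h : ∀ p : ℕ, p.Prime → (p : ℤ) ∣ a → (p : ℤ) ∣ b → False) : IsCoprime a b := by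
  rw [Int.isCoprime_iff_gcd_eq_one, Int.gcd_eq_natAbs]
  exact Nat.coprime_of_dvd fun k hk hka hkb =>
    h k hk (Int.natCast_dvd.mpr hka) (Int.natCast_dvd.mpr hkb)

/-! ### Step 2: pairwise coprime odd fillers by the Euclid trick -/

/-- Running products `P₀ = B`, `P_{i+1} = P_i (2 P_i + 1)`. [folklore] -/
def eucP (B : ℤ) : ℕ → ℤ
  | 0 => B
  | i + 1 => eucP B i * (2 * eucP B i + 1)

/-- The fillers `q_i = 2 P_i + 1`: odd, pairwise coprime, coprime to `B`. [folklore] -/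
def eucQ (B : ℤ) (i : ℕ) : ℤ := 2 * eucP B i + 1

/-- `P_{i+1} = P_i q_i`. [folklore] -/
theorem eucP_succ (B : ℤ) (i : ℕ) : eucP B (i + 1) = eucP B i * eucQ B i := rfl

/-- `P_i > 0` for `B > 0`. [folklore] -/
theorem eucP_pos {B : ℤ} (hB : 0 < B) (i : ℕ) : 0 < eucP B i := by
  induction i with
  | zero => exact hB
  | succ i ih => rw [eucP_succ, eucQ]; positivity

/-- `q_i > 0` for `B > 0`. [folklore] -/
theorem eucQ_pos {B : ℤ} (hB : 0 < B) (i : ℕ) : 0 < eucQ B i := by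
  have := eucP_pos hB i; rw [eucQ]; positivity

/-- `q_i ≥ 3` for `B > 0`. [folklore] -/
theorem three_le_eucQ {B : ℤ} (hB : 0 < B) (i : ℕ) : 3 ≤ eucQ B i := by
  have := eucP_pos hB i; rw [eucQ]; omega

/-- `q_i` is odd. [folklore] -/
theorem odd_eucQ (B : ℤ) (i : ℕ) : Odd (eucQ B i) := ⟨eucP B i, rfl⟩

/-- `B ∣ P_i`. [folklore] -/
theorem dvd_eucP (B : ℤ) (i : ℕ) : B ∣ eucP B i := by
  induction i with
  | zero => exact dvd_rfl
  | succ i ih => rw [eucP_succ]; exact ih.mul_right _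

/-- `q_j ∣ P_i` for `j < i`. [folklore] -/
theorem eucQ_dvd_eucP (B : ℤ) {j i : ℕ} (h : j < i) : eucQ B j ∣ eucP B i := by
  induction i with
  | zero => omega
  | succ i ih =>
    rw [eucP_succ]
    rcases Nat.lt_succ_iff_lt_or_eq.mp h with h | rfl
    · exact (ih h).mul_right _
    · exact dvd_mul_left _ _

/-- `gcd(q_i, P_i) = 1` (as `q_i − 2P_i = 1`). [folklore] -/
theorem isCoprime_eucQ_eucP (B : ℤ) (i : ℕ) : IsCoprime (eucQ B i) (eucP B i) :=
  ⟨1, -2, by rw [eucQ]; ring⟩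

/-- `gcd(q_i, B) = 1`. [folklore] -/
theorem isCoprime_eucQ_base (B : ℤ) (i : ℕ) : IsCoprime (eucQ B i) B :=
  (isCoprime_eucQ_eucP B i).of_isCoprime_of_dvd_right (dvd_eucP B i)

/-- The `q_i` are pairwise coprime (Euclid's trick: `q_i ≡ 1 (mod q_j)` for `j < i`). [folklore] -/
theorem isCoprime_eucQ {B : ℤ} {i j : ℕ} (h : i ≠ j) : IsCoprime (eucQ B i) (eucQ B j) := by
  rcases Nat.lt_or_gt_of_ne h with h | h
  · exact ((isCoprime_eucQ_eucP B j).of_isCoprime_of_dvd_right (eucQ_dvd_eucP B h)).symm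
  · exact (isCoprime_eucQ_eucP B i).of_isCoprime_of_dvd_right (eucQ_dvd_eucP B h)

/-- The constant entries of the construction: for an odd `B > 0`, any `c > 0` and any `m` there are
`v > 0 > w` with `v` odd and odd fillers `q : Fin m → ℤ`, `q_j ≥ 3`, such that `v + w = c + ∑ q_j` and
`v, w, q_0, …, q_{m-1}, B` are pairwise coprime (except that nothing is claimed about `B` with itself).
Replaces "let `a_7, …, a_n` be negated odd primes … apply Lemma 15 to `u` and `m`".
[cite: HolzlKleineStephan2025, proof of Theorem 13] -/
theorem exists_constants {B c : ℤ} (hB : 0 < B) (hBodd : Odd B) (hc : 0 < c) (m : ℕ) :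
    ∃ (v w : ℤ) (q : Fin m → ℤ),
      0 < v ∧ w < 0 ∧ Odd v ∧ (∀ j, 3 ≤ q j) ∧ (∀ j, Odd (q j)) ∧
      v + w = c + ∑ j, q j ∧
      IsCoprime v w ∧ IsCoprime v B ∧ IsCoprime w B ∧ (∀ j, IsCoprime (q j) B) ∧
      (∀ j, IsCoprime v (q j)) ∧ (∀ j, IsCoprime w (q j)) ∧
      (∀ i j, i ≠ j → IsCoprime (q i) (q j)) := by
  set q : Fin m → ℤ := fun j => eucQ B j with hq
  set u : ℤ := c + ∑ j, q j with hu
  have hq3 : ∀ j, 3 ≤ q j := fun j => three_le_eucQ hB j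
  have hu0 : 0 < u := by
    have : 0 ≤ ∑ j, q j := Finset.sum_nonneg fun j _ => by linarith [hq3 j]
    linarith
  set M : ℤ := B * (∏ j, q j) * u with hM
  have hM0 : M ≠ 0 := by
    have : 0 < ∏ j, q j := Finset.prod_pos fun j _ => by linarith [hq3 j]
    positivity
  set S : Finset ℕ := M.natAbs.primeFactors.filter (· ≠ 2) with hSdef
  have hS : ∀ p ∈ S, p.Prime ∧ p ≠ 2 := by
    intro p hp
    rw [hSdef, Finset.mem_filter] at hp
    exact ⟨Nat.prime_of_mem_primeFactors hp.1, hp.2⟩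
  have hmemS : ∀ p : ℕ, p.Prime → p ≠ 2 → (p : ℤ) ∣ M → p ∈ S := by
    intro p hp hp2 hpM
    rw [hSdef, Finset.mem_filter, Nat.mem_primeFactors]
    exact ⟨⟨hp, Int.natCast_dvd.mp hpM, Int.natAbs_ne_zero.mpr hM0⟩, hp2⟩
  obtain ⟨r, hKr, hrodd, hr⟩ := exists_odd_forall_not_dvd u (u + 1) S hS
  have h2r : ¬ (2 : ℤ) ∣ r := fun h => (Int.not_even_iff_odd.mpr hrodd) (even_iff_two_dvd.mpr h)
  -- an odd divisor `z` of `M` is coprime to `r` and to `u - r`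
  have hcop : ∀ z : ℤ, Odd z → z ∣ M → IsCoprime r z ∧ IsCoprime (u - r) z := by
    intro z hz hzM
    have h2z : ¬ (2 : ℤ) ∣ z := fun h => (Int.not_even_iff_odd.mpr hz) (even_iff_two_dvd.mpr h)
    constructor
    · refine isCoprime_of_forall_prime fun p hp hpr hpz => ?_
      have hp2 : p ≠ 2 := by rintro rfl; exact h2z (by exact_mod_cast hpz)
      exact (hr p (hmemS p hp hp2 (hpz.trans hzM))).1 hpr
    · refine isCoprime_of_forall_prime fun p hp hpr hpz => ?_
      have hp2 : p ≠ 2 := by rintro rfl; exact h2z (by exact_mod_cast hpz)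
      exact (hr p (hmemS p hp hp2 (hpz.trans hzM))).2 hpr
  have hBM : B ∣ M := ⟨(∏ j, q j) * u, by rw [hM]; ring⟩
  have hqM : ∀ j, q j ∣ M := fun j =>
    ((Finset.dvd_prod_of_mem q (Finset.mem_univ j)).mul_left B).mul_right u
  refine ⟨r, u - r, q, by linarith, by linarith, hrodd, hq3, fun j => odd_eucQ B j, by rw [hu]; ring,
    ?_, (hcop B hBodd hBM).1, (hcop B hBodd hBM).2, fun j => isCoprime_eucQ_base B j,
    fun j => (hcop (q j) (odd_eucQ B j) (hqM j)).1, fun j => (hcop (q j) (odd_eucQ B j) (hqM j)).2,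
    fun i j hij => isCoprime_eucQ (Fin.val_injective.ne hij)⟩
  refine isCoprime_of_forall_prime fun p hp hpr hpw => ?_
  have hpu : (p : ℤ) ∣ u := by
    have := dvd_add hpr hpw
    rwa [add_sub_cancel] at this
  have hpM : (p : ℤ) ∣ M := hpu.mul_left _
  have hp2 : p ≠ 2 := by rintro rfl; exact h2r (by exact_mod_cast hpr)
  exact (hr p (hmemS p hp hp2 hpM)).1 hpr

/-! ### Step 3: the four polynomial entries of Theorem 13 and their pairwise coprimality -/

/-- The identity behind Theorem 13:
`(x+y)⁵ − (x−y)⁵ − (10y−1)x⁴ − (x²+10y³)² = 2y⁵ − 100y⁶`, independent of `x`.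
[cite: HolzlKleineStephan2025, proof of Theorem 13, (‡)] -/
theorem hks_identity (x y : ℤ) :
    (x + y) ^ 5 - (x - y) ^ 5 - (10 * y - 1) * x ^ 4 - (x ^ 2 + 10 * y ^ 3) ^ 2 =
      2 * y ^ 5 - 100 * y ^ 6 := by
  ring

/-- `IsCoprime a b'` and `b = b' + k a` give `IsCoprime a b` (reduction mod `a`). [folklore] -/
theorem isCoprime_of_eq_add_mul {a b b' : ℤ} (k : ℤ) (h : IsCoprime a b') (he : b = b' + k * a) :
    IsCoprime a b := by
  rw [he]; exact h.add_mul_right_right k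

/-- An odd integer is coprime to `2`. [folklore] -/
theorem isCoprime_two_of_odd {a : ℤ} (ha : Odd a) : IsCoprime a 2 := by
  obtain ⟨k, rfl⟩ := ha
  exact ⟨1, -k, by ring⟩

/-- `a₁ = (x+y)⁵` and `a₂ = −(x−y)⁵` are coprime when `x + y` is odd and `gcd(x, y) = 1`.
[cite: HolzlKleineStephan2025, proof of Theorem 13] -/
theorem isCoprime_A1_A2 {x y : ℤ} (hxy : IsCoprime x y) (hodd : Odd (x + y)) :
    IsCoprime ((x + y) ^ 5) (-(x - y) ^ 5) := by
  have h1 : IsCoprime (x + y) y := by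
    simpa using hxy.add_mul_left_left 1
  have h2 : IsCoprime (x + y) (-(2 * y)) := ((isCoprime_two_of_odd hodd).mul_right h1).neg_right
  have h3 : IsCoprime (x + y) (x - y) := isCoprime_of_eq_add_mul 1 h2 (by ring)
  exact h3.pow.neg_right

/-- `a₁ = (x+y)⁵` and `a₃ = −(10y−1)x⁴` are coprime when `x ≡ 1 (mod 10y−1)`, `gcd(y+1, 10y−1) = 1`
and `gcd(x, y) = 1`. [cite: HolzlKleineStephan2025, proof of Theorem 13 and Lemma 18] -/
theorem isCoprime_A1_A3 {x y : ℤ} (hxy : IsCoprime x y) (hx : 10 * y - 1 ∣ x - 1)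
    (hY : IsCoprime (10 * y - 1) (y + 1)) :
    IsCoprime ((x + y) ^ 5) (-((10 * y - 1) * x ^ 4)) := by
  obtain ⟨k, hk⟩ := hx
  have h1 : IsCoprime (10 * y - 1) (x + y) :=
    isCoprime_of_eq_add_mul k hY (by linear_combination hk)
  have h2 : IsCoprime x (x + y) := isCoprime_of_eq_add_mul 1 hxy (by ring)
  exact (h1.symm.mul_right h2.symm.pow_right).pow_left.neg_right

/-- `a₁ = (x+y)⁵` and `a₄ = −(x²+10y³)²` are coprime when `x ≡ 1 (mod 10y+1)`,
`gcd(y+1, 10y+1) = 1` and `gcd(x, y) = 1` (`x² + 10y³ = (x+y)(x−y) + y²(10y+1)`).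
[cite: HolzlKleineStephan2025, proof of Theorem 13] -/
theorem isCoprime_A1_A4 {x y : ℤ} (hxy : IsCoprime x y) (hx : 10 * y + 1 ∣ x - 1)
    (hY : IsCoprime (10 * y + 1) (y + 1)) :
    IsCoprime ((x + y) ^ 5) (-(x ^ 2 + 10 * y ^ 3) ^ 2) := by
  obtain ⟨k, hk⟩ := hx
  have h1 : IsCoprime (10 * y + 1) (x + y) :=
    isCoprime_of_eq_add_mul k hY (by linear_combination hk)
  have h2 : IsCoprime (x + y) y := by simpa using hxy.add_mul_left_left 1
  have h3 : IsCoprime (x + y) (y ^ 2 * (10 * y + 1)) := h2.pow_right.mul_right h1.symm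
  have h4 : IsCoprime (x + y) (x ^ 2 + 10 * y ^ 3) := isCoprime_of_eq_add_mul (x - y) h3 (by ring)
  exact h4.pow.neg_right

/-- `a₂` and `a₃` are coprime when `x ≡ 1 (mod 10y−1)`, `gcd(y−1, 10y−1) = 1`, `gcd(x, y) = 1`.
[cite: HolzlKleineStephan2025, proof of Theorem 13 and Lemma 18] -/
theorem isCoprime_A2_A3 {x y : ℤ} (hxy : IsCoprime x y) (hx : 10 * y - 1 ∣ x - 1)
    (hY : IsCoprime (10 * y - 1) (1 - y)) :
    IsCoprime (-(x - y) ^ 5) (-((10 * y - 1) * x ^ 4)) := by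
  obtain ⟨k, hk⟩ := hx
  have h1 : IsCoprime (10 * y - 1) (x - y) :=
    isCoprime_of_eq_add_mul k hY (by linear_combination hk)
  have h2 : IsCoprime x (x - y) := isCoprime_of_eq_add_mul 1 hxy.neg_right (by ring)
  exact (h1.symm.mul_right h2.symm.pow_right).pow_left.neg_right.neg_left

/-- `a₂` and `a₄` are coprime when `x ≡ 1 (mod 10y+1)`, `gcd(y−1, 10y+1) = 1`, `gcd(x, y) = 1`.
[cite: HolzlKleineStephan2025, proof of Theorem 13] -/
theorem isCoprime_A2_A4 {x y : ℤ} (hxy : IsCoprime x y) (hx : 10 * y + 1 ∣ x - 1)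
    (hY : IsCoprime (10 * y + 1) (1 - y)) :
    IsCoprime (-(x - y) ^ 5) (-(x ^ 2 + 10 * y ^ 3) ^ 2) := by
  obtain ⟨k, hk⟩ := hx
  have h1 : IsCoprime (10 * y + 1) (x - y) :=
    isCoprime_of_eq_add_mul k hY (by linear_combination hk)
  have h2 : IsCoprime (x - y) y :=
    (isCoprime_of_eq_add_mul (-1) hxy.symm (show x - y = x + (-1) * y by ring)).symm
  have h3 : IsCoprime (x - y) (y ^ 2 * (10 * y + 1)) := h2.pow_right.mul_right h1.symm
  have h4 : IsCoprime (x - y) (x ^ 2 + 10 * y ^ 3) := isCoprime_of_eq_add_mul (x + y) h3 (by ring)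
  exact h4.pow.neg_right.neg_left

/-- `a₃` and `a₄` are coprime when `x ≡ 1 (mod 10y−1)`, `gcd(10y−1, 10y³+1) = 1`,
`gcd(x, 10) = gcd(x, y) = 1`. [cite: HolzlKleineStephan2025, proof of Theorem 13] -/
theorem isCoprime_A3_A4 {x y : ℤ} (hxy : IsCoprime x y) (hx10 : IsCoprime x 10)
    (hx : 10 * y - 1 ∣ x - 1) (hY : IsCoprime (10 * y - 1) (1 + 10 * y ^ 3)) :
    IsCoprime (-((10 * y - 1) * x ^ 4)) (-(x ^ 2 + 10 * y ^ 3) ^ 2) := by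
  obtain ⟨k, hk⟩ := hx
  have h1 : IsCoprime (10 * y - 1) (x ^ 2 + 10 * y ^ 3) :=
    isCoprime_of_eq_add_mul (2 * k + k ^ 2 * (10 * y - 1)) hY (by
      have : x = 1 + (10 * y - 1) * k := by linear_combination hk
      rw [this]; ring)
  have hx' : IsCoprime x (10 * y ^ 3) := hx10.mul_right hxy.pow_right
  have h2 : IsCoprime x (x ^ 2 + 10 * y ^ 3) := isCoprime_of_eq_add_mul x hx' (by ring)
  exact (h1.mul_left h2.pow_left).pow_right.neg_right.neg_left

/-- Cross coprimality: an integer `z` with `x ≡ 1 (mod z)` that is coprime to `y + 1`, `y − 1`,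
`10y − 1` and `10y³ + 1` is coprime to each of `a₁, a₂, a₃, a₄` ("for these primes `p` we have
`x ≡ 1`, `x + y ≡ 1 + y`, `x − y ≡ 1 − y`, `x² + 10y³ ≡ 1 + 10y³ (mod p)`").
[cite: HolzlKleineStephan2025, proof of Theorem 13] -/
theorem isCoprime_cross {x y z : ℤ} (hx : z ∣ x - 1) (h1 : IsCoprime z (y + 1))
    (h2 : IsCoprime z (y - 1)) (h3 : IsCoprime z (10 * y - 1)) (h4 : IsCoprime z (10 * y ^ 3 + 1)) :
    IsCoprime z ((x + y) ^ 5) ∧ IsCoprime z (-(x - y) ^ 5) ∧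
      IsCoprime z (-((10 * y - 1) * x ^ 4)) ∧ IsCoprime z (-(x ^ 2 + 10 * y ^ 3) ^ 2) := by
  obtain ⟨k, hk⟩ := hx
  have hx' : x = 1 + k * z := by linear_combination hk
  have hzx : IsCoprime z x := isCoprime_of_eq_add_mul k isCoprime_one_right hx'
  refine ⟨?_, ?_, ?_, ?_⟩
  · exact (isCoprime_of_eq_add_mul k h1 (show x + y = y + 1 + k * z by rw [hx']; ring)).pow_right
  · exact (isCoprime_of_eq_add_mul k h2.neg_right
      (show x - y = -(y - 1) + k * z by rw [hx']; ring)).pow_right.neg_right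
  · exact (h3.mul_right hzx.pow_right).neg_right
  · exact (isCoprime_of_eq_add_mul (2 * k + k ^ 2 * z) h4
      (show x ^ 2 + 10 * y ^ 3 = 10 * y ^ 3 + 1 + (2 * k + k ^ 2 * z) * z by
        rw [hx']; ring)).pow_right.neg_right

/-! ### Step 4: no vanishing proper subsum, from the sign pattern -/

/-- Sign lemma for the subsum condition. If `∑ a = 0`, `a i₁ > 0`, every index other than `i₀, i₁`
carries a negative entry and is either "big" (`a i + a i₁ < 0`) or lies in `R ∌ i₀, i₁`, and
`a i₁ + ∑_{i ∈ R} a i > 0`, then no nonempty proper subsum of `a` vanishes: passing to the complement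
one may assume `i₀ ∉ s`; a big index in `s` forces `∑_s a < 0`; otherwise `s ⊆ {i₁} ∪ R` and the sum
is `> 0` if `i₁ ∈ s`, `< 0` if not. (An abstract form of the verification of the subsum condition
(iii) in the proof of Theorem 13 of Hölzl–Kleine–Stephan, for `{0,1}`-coefficients.) [folklore] -/
theorem sum_ne_zero_of_pattern {ι : Type*} [Fintype ι] [DecidableEq ι] (a : ι → ℤ) (i₀ i₁ : ι)
    (R : Finset ι) (hR0 : i₀ ∉ R) (hR1 : i₁ ∉ R) (hsum : ∑ i, a i = 0) (hpos : 0 < a i₁)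
    (hneg : ∀ i, i ≠ i₀ → i ≠ i₁ → a i < 0)
    (hbig : ∀ i, i ≠ i₀ → i ≠ i₁ → i ∉ R → a i + a i₁ < 0)
    (hRsum : 0 < a i₁ + ∑ i ∈ R, a i)
    (s : Finset ι) (hs : s.Nonempty) (hs' : s ≠ Finset.univ) : ∑ i ∈ s, a i ≠ 0 := by
  have key : ∀ s : Finset ι, i₀ ∉ s → s.Nonempty → ∑ i ∈ s, a i ≠ 0 := by
    intro s h0 hne
    by_cases hb : ∃ i ∈ s, i ≠ i₁ ∧ i ∉ R
    · obtain ⟨i, hi, hi1, hiR⟩ := hb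
      have hi0 : i ≠ i₀ := fun h => h0 (h ▸ hi)
      have hle : ∑ j ∈ s.erase i, a j ≤ a i₁ := by
        calc ∑ j ∈ s.erase i, a j ≤ ∑ j ∈ s.erase i, (if j = i₁ then a i₁ else 0) := by
              refine Finset.sum_le_sum fun j hj => ?_
              split_ifs with h
              · rw [h]
              · have hj0 : j ≠ i₀ := fun h' => h0 (h' ▸ Finset.mem_of_mem_erase hj)
                exact (hneg j hj0 h).le
          _ ≤ a i₁ := by
              rw [Finset.sum_ite_eq']
              split_ifs
              · exact le_rfl
              · exact hpos.le
      intro hzero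
      rw [← Finset.add_sum_erase s a hi] at hzero
      have := hbig i hi0 hi1 hiR
      linarith
    · push Not at hb
      by_cases h1 : i₁ ∈ s
      · intro hzero
        rw [← Finset.add_sum_erase s a h1] at hzero
        have hsub : s.erase i₁ ⊆ R := fun j hj =>
          hb j (Finset.mem_of_mem_erase hj) (Finset.ne_of_mem_erase hj)
        have hge : ∑ j ∈ R, a j ≤ ∑ j ∈ s.erase i₁, a j := by
          rw [← Finset.sum_sdiff hsub]
          have : ∑ j ∈ R \ s.erase i₁, a j ≤ 0 :=
            Finset.sum_nonpos fun j hj => by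
              have hjR : j ∈ R := (Finset.mem_sdiff.mp hj).1
              exact (hneg j (fun h => hR0 (h ▸ hjR)) (fun h => hR1 (h ▸ hjR))).le
          linarith
        linarith
      · have : ∑ j ∈ s, a j < 0 :=
          Finset.sum_neg (fun j hj => hneg j (fun h => h0 (h ▸ hj)) (fun h => h1 (h ▸ hj))) hne
        exact this.ne
  by_cases h0 : i₀ ∈ s
  · have hc : sᶜ.Nonempty := by
      rw [Finset.nonempty_iff_ne_empty, Ne, Finset.compl_eq_empty_iff]; exact hs'
    have h0' : i₀ ∉ sᶜ := fun h => (Finset.mem_compl.mp h) h0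
    intro h
    apply key sᶜ h0' hc
    have htot : ∑ i ∈ s, a i + ∑ i ∈ sᶜ, a i = 0 := by rw [Finset.sum_add_sum_compl, hsum]
    linarith
  · exact key s h0 hs

/-! ### Step 5: the tuples of Theorem 13 -/

/-- The six special entries `(a₁, a₂, a₃, a₄, a₅, a₆) = ((x+y)⁵, −(x−y)⁵, −(10y−1)x⁴, −(x²+10y³)², v, w)`.
[cite: HolzlKleineStephan2025, proof of Theorem 13] -/
def hksSix (x y v w : ℤ) : Fin 6 → ℤ :=
  ![(x + y) ^ 5, -(x - y) ^ 5, -((10 * y - 1) * x ^ 4), -(x ^ 2 + 10 * y ^ 3) ^ 2, v, w]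

/-- The `(m + 6)`-tuple of Theorem 13 indexed by `Fin m ⊕ Fin 6`: the fillers `−q_j` (the paper's
`a₇, …, a_n`) on the left, the six special entries on the right. [cite: HolzlKleineStephan2025, proof of Theorem 13] -/
def hksFun (m : ℕ) (x y v w : ℤ) (q : Fin m → ℤ) : Fin m ⊕ Fin 6 → ℤ :=
  Sum.elim (fun j => -q j) (hksSix x y v w)

/-- The standing hypotheses on the parameters `x, y, v, w, q` of the construction (all of them are
verified for `y = 330`, `x = 331^{φ(L) t}` and the constants of `exists_constants` below).
[cite: HolzlKleineStephan2025, proof of Theorem 13] -/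
structure HKSData (m : ℕ) (x y v w : ℤ) (q : Fin m → ℤ) : Prop where
  y_pos : 0 < y
  x_gt : v + y < x
  v_pos : 0 < v
  w_neg : w < 0
  q_pos : ∀ j, 0 < q j
  vw : v + w = (100 * y ^ 6 - 2 * y ^ 5) + ∑ j, q j
  cop_xy : IsCoprime x y
  cop_x10 : IsCoprime x 10
  odd : Odd (x + y)
  dvd₁ : 10 * y - 1 ∣ x - 1
  dvd₂ : 10 * y + 1 ∣ x - 1
  dvd_v : v ∣ x - 1
  dvd_w : w ∣ x - 1
  dvd_q : ∀ j, q j ∣ x - 1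
  Y₁ : IsCoprime (10 * y - 1) (y + 1)
  Y₂ : IsCoprime (10 * y - 1) (1 - y)
  Y₃ : IsCoprime (10 * y + 1) (y + 1)
  Y₄ : IsCoprime (10 * y + 1) (1 - y)
  Y₅ : IsCoprime (10 * y - 1) (1 + 10 * y ^ 3)
  cop_vB : IsCoprime v ((y + 1) * (y - 1) * (10 * y - 1) * (10 * y ^ 3 + 1))
  cop_wB : IsCoprime w ((y + 1) * (y - 1) * (10 * y - 1) * (10 * y ^ 3 + 1))
  cop_qB : ∀ j, IsCoprime (q j) ((y + 1) * (y - 1) * (10 * y - 1) * (10 * y ^ 3 + 1))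
  cop_vw : IsCoprime v w
  cop_vq : ∀ j, IsCoprime v (q j)
  cop_wq : ∀ j, IsCoprime w (q j)
  cop_qq : ∀ i j, i ≠ j → IsCoprime (q i) (q j)

namespace HKSData

variable {m : ℕ} {x y v w : ℤ} {q : Fin m → ℤ}

/-- The tuple sums to zero. [cite: HolzlKleineStephan2025, proof of Theorem 13, condition (ii)] -/
theorem sum_eq_zero (h : HKSData m x y v w q) : ∑ k, hksFun m x y v w q k = 0 := by
  rw [Fintype.sum_sum_type]
  simp only [hksFun, Sum.elim_inl, Sum.elim_inr, Finset.sum_neg_distrib]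
  rw [Fin.sum_univ_six]
  simp only [hksSix, Matrix.cons_val_zero, Matrix.cons_val_one, Matrix.cons_val]
  linear_combination hks_identity x y + h.vw

/-- Splitting the coprimality with `B = (y+1)(y−1)(10y−1)(10y³+1)`. [folklore] -/
theorem cop_split {z : ℤ} (hz : IsCoprime z ((y + 1) * (y - 1) * (10 * y - 1) * (10 * y ^ 3 + 1))) :
    IsCoprime z (y + 1) ∧ IsCoprime z (y - 1) ∧ IsCoprime z (10 * y - 1) ∧
      IsCoprime z (10 * y ^ 3 + 1) :=
  ⟨hz.of_mul_right_left.of_mul_right_left.of_mul_right_left,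
    hz.of_mul_right_left.of_mul_right_left.of_mul_right_right,
    hz.of_mul_right_left.of_mul_right_right, hz.of_mul_right_right⟩

/-- A constant `z ∈ {v, w, q_j}` is coprime to each of the four polynomial entries. [cite: HolzlKleineStephan2025, proof of Theorem 13] -/
theorem cross (v w : ℤ) {z : ℤ} (hzx : z ∣ x - 1)
    (hz : IsCoprime z ((y + 1) * (y - 1) * (10 * y - 1) * (10 * y ^ 3 + 1))) (i : Fin 4) :
    IsCoprime z (hksSix x y v w (Fin.castLE (by norm_num) i)) := by
  obtain ⟨h1, h2, h3, h4⟩ := cop_split hz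
  obtain ⟨c1, c2, c3, c4⟩ := isCoprime_cross hzx h1 h2 h3 h4
  fin_cases i
  · exact c1
  · exact c2
  · exact c3
  · exact c4

/-- The six special entries are pairwise coprime. [cite: HolzlKleineStephan2025, proof of Theorem 13, condition (i)] -/
theorem pairwise_six (h : HKSData m x y v w q) :
    Pairwise fun k l => IsCoprime (hksSix x y v w k) (hksSix x y v w l) := by
  have h01 := isCoprime_A1_A2 h.cop_xy h.odd
  have h02 := isCoprime_A1_A3 h.cop_xy h.dvd₁ h.Y₁
  have h03 := isCoprime_A1_A4 h.cop_xy h.dvd₂ h.Y₃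
  have h12 := isCoprime_A2_A3 h.cop_xy h.dvd₁ h.Y₂
  have h13 := isCoprime_A2_A4 h.cop_xy h.dvd₂ h.Y₄
  have h23 := isCoprime_A3_A4 h.cop_xy h.cop_x10 h.dvd₁ h.Y₅
  have hv0 := (cross v w h.dvd_v h.cop_vB 0).symm
  have hv1 := (cross v w h.dvd_v h.cop_vB 1).symm
  have hv2 := (cross v w h.dvd_v h.cop_vB 2).symm
  have hv3 := (cross v w h.dvd_v h.cop_vB 3).symm
  have hw0 := (cross v w h.dvd_w h.cop_wB 0).symm
  have hw1 := (cross v w h.dvd_w h.cop_wB 1).symm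
  have hw2 := (cross v w h.dvd_w h.cop_wB 2).symm
  have hw3 := (cross v w h.dvd_w h.cop_wB 3).symm
  have hvw := h.cop_vw
  intro k l hkl
  fin_cases k <;> fin_cases l
  all_goals first | exact absurd rfl hkl | skip
  · exact h01
  · exact h02
  · exact h03
  · exact hv0
  · exact hw0
  · exact h01.symm
  · exact h12
  · exact h13
  · exact hv1
  · exact hw1
  · exact h02.symm
  · exact h12.symm
  · exact h23
  · exact hv2
  · exact hw2
  · exact h03.symm
  · exact h13.symm
  · exact h23.symm
  · exact hv3
  · exact hw3
  · exact hv0.symm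
  · exact hv1.symm
  · exact hv2.symm
  · exact hv3.symm
  · exact hvw
  · exact hw0.symm
  · exact hw1.symm
  · exact hw2.symm
  · exact hw3.symm
  · exact hvw.symm

/-- All entries of the tuple are pairwise coprime. [cite: HolzlKleineStephan2025, proof of Theorem 13, condition (i)] -/
theorem pairwise (h : HKSData m x y v w q) :
    Pairwise fun k l => IsCoprime (hksFun m x y v w q k) (hksFun m x y v w q l) := by
  have hq6 : ∀ (j : Fin m) (l : Fin 6), IsCoprime (-q j) (hksSix x y v w l) := by
    intro j l
    refine IsCoprime.neg_left ?_
    fin_cases l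
    · exact cross v w (h.dvd_q j) (h.cop_qB j) 0
    · exact cross v w (h.dvd_q j) (h.cop_qB j) 1
    · exact cross v w (h.dvd_q j) (h.cop_qB j) 2
    · exact cross v w (h.dvd_q j) (h.cop_qB j) 3
    · exact (h.cop_vq j).symm
    · exact (h.cop_wq j).symm
  rintro (j | k) (j' | l) hne
  · exact ((h.cop_qq j j' fun e => hne (congrArg Sum.inl e)).neg_left).neg_right
  · exact hq6 j l
  · exact (hq6 j' k).symm
  · exact h.pairwise_six fun e => hne (congrArg Sum.inr e)

/-- The filler-and-`w` index set `R = {a₆} ∪ {fillers}`. [folklore] -/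
def rset (m : ℕ) : Finset (Fin m ⊕ Fin 6) :=
  insert (Sum.inr 5) (Finset.univ.map ⟨Sum.inl, Sum.inl_injective⟩)

/-- Membership in `rset`. [folklore] -/
theorem mem_rset {m : ℕ} (k : Fin m ⊕ Fin 6) :
    k ∈ rset m ↔ k = Sum.inr 5 ∨ ∃ j, k = Sum.inl j := by
  simp [rset, eq_comm]

/-- No nonempty proper subsum of the tuple vanishes. [cite: HolzlKleineStephan2025, proof of Theorem 13, condition (iii)] -/
theorem subsum (h : HKSData m x y v w q) (s : Finset (Fin m ⊕ Fin 6)) (hs : s.Nonempty)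
    (hs' : s ≠ Finset.univ) : ∑ k ∈ s, hksFun m x y v w q k ≠ 0 := by
  classical
  have hx1 : 1 ≤ x := by linarith [h.x_gt, h.v_pos, h.y_pos]
  have hxv : v < x := by linarith [h.x_gt, h.y_pos]
  have hxy : v < x - y := by linarith [h.x_gt]
  refine sum_ne_zero_of_pattern (hksFun m x y v w q) (Sum.inr 0) (Sum.inr 4) (rset m)
    (by simp [mem_rset]) (by simp [mem_rset]) h.sum_eq_zero h.v_pos ?_ ?_ ?_ s hs hs'
  · rintro (j | k) hk0 hk1
    · show -q j < 0
      linarith [h.q_pos j]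
    · fin_cases k
      · exact absurd rfl hk0
      · show -(x - y) ^ 5 < 0
        have : 0 < x - y := by linarith [h.v_pos]
        have := pow_pos this 5
        linarith
      · show -((10 * y - 1) * x ^ 4) < 0
        have h1 : 0 < 10 * y - 1 := by linarith [h.y_pos]
        have h2 : 0 < x ^ 4 := by positivity
        have := mul_pos h1 h2
        linarith
      · show -(x ^ 2 + 10 * y ^ 3) ^ 2 < 0
        have : 0 < x ^ 2 + 10 * y ^ 3 := by have := h.y_pos; positivity
        have := pow_pos this 2
        linarith
      · exact absurd rfl hk1
      · exact h.w_neg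
  · rintro (j | k) hk0 hk1 hkR
    · exact absurd ((mem_rset _).mpr (Or.inr ⟨j, rfl⟩)) hkR
    · fin_cases k
      · exact absurd rfl hk0
      · show -(x - y) ^ 5 + v < 0
        have h1 : x - y ≤ (x - y) ^ 5 := le_self_pow₀ (by linarith [h.v_pos]) (by norm_num)
        linarith
      · show -((10 * y - 1) * x ^ 4) + v < 0
        have h1 : x ≤ x ^ 4 := le_self_pow₀ hx1 (by norm_num)
        have h2 : x ^ 4 ≤ (10 * y - 1) * x ^ 4 := by
          have : (1 : ℤ) ≤ 10 * y - 1 := by linarith [h.y_pos]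
          have : (0 : ℤ) ≤ x ^ 4 := by positivity
          nlinarith
        linarith
      · show -(x ^ 2 + 10 * y ^ 3) ^ 2 + v < 0
        have h1 : x ≤ x ^ 2 := le_self_pow₀ hx1 (by norm_num)
        have h2 : x ^ 2 ≤ x ^ 2 + 10 * y ^ 3 := by have := pow_pos h.y_pos 3; linarith
        have h3 : x ^ 2 + 10 * y ^ 3 ≤ (x ^ 2 + 10 * y ^ 3) ^ 2 :=
          le_self_pow₀ (by nlinarith) (by norm_num)
        linarith
      · exact absurd rfl hk1
      · exact absurd ((mem_rset _).mpr (Or.inl rfl)) hkR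
  · have hnot : (Sum.inr 5 : Fin m ⊕ Fin 6) ∉ Finset.univ.map ⟨Sum.inl, Sum.inl_injective⟩ := by
      simp
    rw [rset, Finset.sum_insert hnot, Finset.sum_map]
    simp only [Function.Embedding.coeFn_mk, hksFun, Sum.elim_inl, Sum.elim_inr,
      Finset.sum_neg_distrib]
    show 0 < v + (hksSix x y v w 5 + -∑ j, q j)
    have e5 : hksSix x y v w 5 = w := rfl
    rw [e5]
    have := h.y_pos
    have : (0 : ℤ) < 100 * y ^ 6 - 2 * y ^ 5 := by nlinarith [pow_pos h.y_pos 5]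
    linarith [h.vw]

/-- All entries are nonzero. [folklore] -/
theorem ne_zero (h : HKSData m x y v w q) (k : Fin m ⊕ Fin 6) : hksFun m x y v w q k ≠ 0 := by
  have hxy : 0 < x - y := by linarith [h.x_gt, h.v_pos]
  have hxy' : 0 < x + y := by linarith [h.x_gt, h.v_pos, h.y_pos]
  have hx : 0 < x := by linarith [h.y_pos]
  rcases k with j | k
  · show -q j ≠ 0
    have := h.q_pos j
    omega
  · fin_cases k
    · show (x + y) ^ 5 ≠ 0; positivity
    · show -(x - y) ^ 5 ≠ 0
      exact neg_ne_zero.mpr (pow_ne_zero 5 hxy.ne')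
    · show -((10 * y - 1) * x ^ 4) ≠ 0
      have : 10 * y - 1 ≠ 0 := by linarith [h.y_pos]
      exact neg_ne_zero.mpr (mul_ne_zero this (pow_ne_zero 4 hx.ne'))
    · show -(x ^ 2 + 10 * y ^ 3) ^ 2 ≠ 0
      have : 0 < x ^ 2 + 10 * y ^ 3 := by have := pow_pos h.y_pos 3; positivity
      exact neg_ne_zero.mpr (pow_ne_zero 2 this.ne')
    · exact h.v_pos.ne'
    · exact h.w_neg.ne

/-- The common base `D = (x+y)(x−y)·(10y−1)b₀·(x²+10y³)·v(−w)·∏ q_j`: at `x = b₀^e` every entry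
divides a power of `D` ("`rad(a₁⋯aₙ)` will be a divisor of `(x+y)(x−y)(10y−1)(y+1)(x²+10y³)a₅⋯aₙ`").
[cite: HolzlKleineStephan2025, proof of Theorem 13] -/
def dBase (m : ℕ) (x y v w b₀ : ℤ) (q : Fin m → ℤ) : ℤ :=
  (x + y) * (x - y) * ((10 * y - 1) * b₀) * (x ^ 2 + 10 * y ^ 3) * (v * -w) * ∏ j, q j

/-- Every entry divides `D^{4e+5}` when `x = b₀^e`. [cite: HolzlKleineStephan2025, proof of Theorem 13] -/
theorem dvd_dBase_pow {b₀ : ℤ} {e : ℕ} (hx : x = b₀ ^ e) (k : Fin m ⊕ Fin 6) :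
    hksFun m x y v w q k ∣ dBase m x y v w b₀ q ^ (4 * e + 5) := by
  set A := x + y
  set B := x - y
  set C := (10 * y - 1) * b₀ with hC
  set E := x ^ 2 + 10 * y ^ 3
  set F := v * -w with hF
  set G := ∏ j, q j with hG
  have hD : dBase m x y v w b₀ q = A * B * C * E * F * G := rfl
  set D := dBase m x y v w b₀ q
  have hA : A ∣ D := hD ▸ ((((dvd_mul_right A B).mul_right C).mul_right E).mul_right F).mul_right G
  have hB : B ∣ D := hD ▸ ((((dvd_mul_left B A).mul_right C).mul_right E).mul_right F).mul_right G
  have hC' : C ∣ D := hD ▸ (((dvd_mul_left C (A * B)).mul_right E).mul_right F).mul_right G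
  have hE : E ∣ D := hD ▸ ((dvd_mul_left E (A * B * C)).mul_right F).mul_right G
  have hF' : F ∣ D := hD ▸ (dvd_mul_left F (A * B * C * E)).mul_right G
  have hG' : G ∣ D := hD ▸ dvd_mul_left G (A * B * C * E * F)
  have hle5 : 5 ≤ 4 * e + 5 := by omega
  have hD1 : D ∣ D ^ (4 * e + 5) := dvd_pow_self D (by omega)
  rcases k with j | k
  · show -q j ∣ D ^ (4 * e + 5)
    exact (neg_dvd.mpr ((Finset.dvd_prod_of_mem q (Finset.mem_univ j)).trans hG')).trans hD1
  · fin_cases k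
    · show A ^ 5 ∣ D ^ (4 * e + 5)
      exact (pow_dvd_pow_of_dvd hA 5).trans (pow_dvd_pow D hle5)
    · show -B ^ 5 ∣ D ^ (4 * e + 5)
      exact (neg_dvd.mpr (pow_dvd_pow_of_dvd hB 5)).trans (pow_dvd_pow D hle5)
    · show -((10 * y - 1) * x ^ 4) ∣ D ^ (4 * e + 5)
      rw [neg_dvd, hx, ← pow_mul]
      have h1 : 10 * y - 1 ∣ D := (dvd_mul_right _ b₀).trans hC'
      have h2 : b₀ ^ (e * 4) ∣ D ^ (e * 4) := pow_dvd_pow_of_dvd ((dvd_mul_left b₀ _).trans hC') _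
      have h3 := mul_dvd_mul h1 h2
      rw [← pow_succ'] at h3
      exact h3.trans (pow_dvd_pow D (by omega))
    · show -E ^ 2 ∣ D ^ (4 * e + 5)
      exact (neg_dvd.mpr (pow_dvd_pow_of_dvd hE 2)).trans (pow_dvd_pow D (by omega))
    · show v ∣ D ^ (4 * e + 5)
      exact ((dvd_mul_right v (-w)).trans hF').trans hD1
    · show w ∣ D ^ (4 * e + 5)
      exact (neg_dvd.mp ((dvd_mul_left (-w) v).trans hF')).trans hD1

/-- Hence the radical of the product divides `D`. [cite: HolzlKleineStephan2025, proof of Theorem 13] -/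
theorem radical_dvd_dBase (h : HKSData m x y v w q) {b₀ : ℤ} {e : ℕ} (hx : x = b₀ ^ e) :
    radical (∏ k, hksFun m x y v w q k) ∣ dBase m x y v w b₀ q := by
  have hne : ∏ k, hksFun m x y v w q k ≠ 0 :=
    Finset.prod_ne_zero_iff.mpr fun k _ => h.ne_zero k
  refine (exists_dvd_pow_iff_radical_dvd hne).mp ⟨(4 * e + 5) * (Finset.univ : Finset (Fin m ⊕ Fin 6)).card, ?_⟩
  rw [pow_mul, ← Finset.prod_const]
  exact Finset.prod_dvd_prod_of_dvd _ _ fun k _ => dvd_dBase_pow hx k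

/-- The constant `K = (y+1)·(10y−1)b₀·(10y³+1)·v(−w)·∏ q_j` with `D ≤ K x⁴`. [folklore] -/
def kConst (m : ℕ) (y v w b₀ : ℤ) (q : Fin m → ℤ) : ℤ :=
  (y + 1) * ((10 * y - 1) * b₀) * (10 * y ^ 3 + 1) * (v * -w) * ∏ j, q j

/-- `K > 0`. [folklore] -/
theorem kConst_pos (h : HKSData m x y v w q) {b₀ : ℤ} (hb : 0 < b₀) : 0 < kConst m y v w b₀ q := by
  have h1 : 0 < y + 1 := by linarith [h.y_pos]
  have h2 : 0 < (10 * y - 1) * b₀ := mul_pos (by linarith [h.y_pos]) hb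
  have h3 : 0 < 10 * y ^ 3 + 1 := by have := pow_pos h.y_pos 3; linarith
  have h4 : 0 < v * -w := mul_pos h.v_pos (by linarith [h.w_neg])
  have h5 : 0 < ∏ j, q j := Finset.prod_pos fun j _ => h.q_pos j
  unfold kConst
  positivity

/-- `D ≤ K x⁴`: "`rad(a₁ ⋯ aₙ)` is bounded from above by a polynomial in `x` of degree at most `4`".
[cite: HolzlKleineStephan2025, proof of Theorem 13] -/
theorem dBase_le (h : HKSData m x y v w q) {b₀ : ℤ} (hb : 0 < b₀) :
    dBase m x y v w b₀ q ≤ kConst m y v w b₀ q * x ^ 4 := by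
  have hx1 : 1 ≤ x := by linarith [h.x_gt, h.v_pos, h.y_pos]
  have hy := h.y_pos
  have hA : x + y ≤ x * (y + 1) := by nlinarith
  have hA0 : 0 ≤ x + y := by linarith
  have hB : x - y ≤ x := by linarith
  have hB0 : 0 ≤ x - y := by linarith [h.x_gt, h.v_pos]
  have hE : x ^ 2 + 10 * y ^ 3 ≤ x ^ 2 * (10 * y ^ 3 + 1) := by
    have : 0 ≤ (x ^ 2 - 1) * (10 * y ^ 3) := mul_nonneg (by nlinarith) (by positivity)
    nlinarith
  have hE0 : 0 ≤ x ^ 2 + 10 * y ^ 3 := by positivity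
  have hR0 : 0 ≤ (10 * y - 1) * b₀ * (v * -w) * ∏ j, q j := by
    have h2 : 0 < (10 * y - 1) * b₀ := mul_pos (by linarith [h.y_pos]) hb
    have h4 : 0 < v * -w := mul_pos h.v_pos (by linarith [h.w_neg])
    have h5 : 0 < ∏ j, q j := Finset.prod_pos fun j _ => h.q_pos j
    positivity
  have key : (x + y) * (x - y) * (x ^ 2 + 10 * y ^ 3) ≤ (x * (y + 1)) * x * (x ^ 2 * (10 * y ^ 3 + 1)) :=
    mul_le_mul (mul_le_mul hA hB hB0 (by positivity)) hE hE0 (by positivity)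
  calc dBase m x y v w b₀ q
      = (x + y) * (x - y) * (x ^ 2 + 10 * y ^ 3) * ((10 * y - 1) * b₀ * (v * -w) * ∏ j, q j) := by
        unfold dBase; ring
    _ ≤ (x * (y + 1)) * x * (x ^ 2 * (10 * y ^ 3 + 1)) * ((10 * y - 1) * b₀ * (v * -w) * ∏ j, q j) :=
        mul_le_mul_of_nonneg_right key hR0
    _ = kConst m y v w b₀ q * x ^ 4 := by unfold kConst; ring

/-! ### Step 6: the tuples as maps `Fin (m + 6) → ℤ`, size and radical -/

/-- The tuple of Theorem 13 as a map `Fin (m + 6) → ℤ`. [cite: HolzlKleineStephan2025, proof of Theorem 13] -/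
def hksTuple (m : ℕ) (x y v w : ℤ) (q : Fin m → ℤ) : Fin (m + 6) → ℤ :=
  fun i => hksFun m x y v w q (finSumFinEquiv.symm i)

/-- Entries of `hksTuple` through the equivalence `Fin m ⊕ Fin 6 ≃ Fin (m + 6)`. [folklore] -/
theorem hksTuple_apply (k : Fin m ⊕ Fin 6) :
    hksTuple m x y v w q (finSumFinEquiv k) = hksFun m x y v w q k := by
  simp [hksTuple]

/-- The product of the entries, transferred. [folklore] -/
theorem prod_hksTuple : ∏ i, hksTuple m x y v w q i = ∏ k, hksFun m x y v w q k :=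
  Equiv.prod_comp finSumFinEquiv.symm (hksFun m x y v w q)

/-- The sum of the entries, transferred. [folklore] -/
theorem sum_hksTuple : ∑ i, hksTuple m x y v w q i = ∑ k, hksFun m x y v w q k :=
  Equiv.sum_comp finSumFinEquiv.symm (hksFun m x y v w q)

/-- The tuple is admissible: zero sum, setwise coprime, no vanishing nonempty proper subsum.
[cite: HolzlKleineStephan2025, proof of Theorem 13] -/
theorem isAdmissibleSum (h : HKSData m x y v w q) : IsAdmissibleSum (hksTuple m x y v w q) := by
  classical
  refine ⟨by rw [sum_hksTuple]; exact h.sum_eq_zero, fun d hd => ?_, fun s hs hs' => ?_⟩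
  · have hv : d ∣ v := by
      have := hd (finSumFinEquiv (Sum.inr 4)); rw [hksTuple_apply] at this; exact this
    have hw : d ∣ w := by
      have := hd (finSumFinEquiv (Sum.inr 5)); rw [hksTuple_apply] at this; exact this
    exact h.cop_vw.isUnit_of_dvd' hv hw
  · have e : ∑ i ∈ s, hksTuple m x y v w q i =
        ∑ k ∈ s.map finSumFinEquiv.symm.toEmbedding, hksFun m x y v w q k := by
      rw [Finset.sum_map]; rfl
    rw [e]
    refine h.subsum _ ((Finset.map_nonempty).mpr hs) fun H => hs' ?_
    rwa [← Finset.map_univ_equiv finSumFinEquiv.symm, Finset.map_inj] at H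

/-- The entries are pairwise coprime. [cite: HolzlKleineStephan2025, proof of Theorem 13] -/
theorem pairwise_tuple (h : HKSData m x y v w q) :
    Pairwise fun i j => IsCoprime (hksTuple m x y v w q i) (hksTuple m x y v w q j) :=
  fun _ _ hij => h.pairwise fun e => hij (finSumFinEquiv.symm.injective e)

/-- Size: `max |aᵢ| ≥ a₁ = (x + y)⁵ ≥ x⁵`. [cite: HolzlKleineStephan2025, proof of Theorem 13] -/
theorem pow_five_le_tupleMax (h : HKSData m x y v w q) :
    x ^ 5 ≤ (tupleMax (hksTuple m x y v w q) : ℤ) := by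
  have hxy : 0 ≤ x + y := by linarith [h.x_gt, h.v_pos, h.y_pos]
  have hx : 0 ≤ x := by linarith [h.x_gt, h.v_pos, h.y_pos]
  have h1 : (hksTuple m x y v w q (finSumFinEquiv (Sum.inr 0))).natAbs ≤
      tupleMax (hksTuple m x y v w q) :=
    Finset.le_sup (f := fun i => (hksTuple m x y v w q i).natAbs) (Finset.mem_univ _)
  have h2 : hksTuple m x y v w q (finSumFinEquiv (Sum.inr 0)) = (x + y) ^ 5 := by
    rw [hksTuple_apply]; rfl
  rw [h2] at h1
  have h3 : ((tupleMax (hksTuple m x y v w q) : ℕ) : ℤ) ≥ (((x + y) ^ 5).natAbs : ℤ) := by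
    exact_mod_cast h1
  rw [Int.natCast_natAbs, abs_of_nonneg (by positivity)] at h3
  calc x ^ 5 ≤ (x + y) ^ 5 := pow_le_pow_left₀ hx (by linarith [h.y_pos]) 5
    _ ≤ _ := h3

/-- The radical exceeds `1`. [folklore] -/
theorem one_lt_radical (h : HKSData m x y v w q) :
    1 < radical (∏ i, hksTuple m x y v w q i) := by
  rw [prod_hksTuple, Int.one_lt_radical_iff]
  have hne : ∏ k, hksFun m x y v w q k ≠ 0 :=
    Finset.prod_ne_zero_iff.mpr fun k _ => h.ne_zero k
  have hdvd : hksFun m x y v w q (Sum.inr 0) ∣ ∏ k, hksFun m x y v w q k :=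
    Finset.dvd_prod_of_mem _ (Finset.mem_univ _)
  have h2 : 2 ≤ (hksFun m x y v w q (Sum.inr 0)).natAbs := by
    show 2 ≤ ((x + y) ^ 5).natAbs
    have hxy : 2 ≤ x + y := by linarith [h.x_gt, h.v_pos, h.y_pos]
    have : (2 : ℤ) ≤ (x + y) ^ 5 := by
      calc (2 : ℤ) ≤ x + y := hxy
        _ ≤ (x + y) ^ 5 := le_self_pow₀ (by linarith) (by norm_num)
    have h' : ((((x + y) ^ 5).natAbs : ℕ) : ℤ) = (x + y) ^ 5 := by
      rw [Int.natCast_natAbs, abs_of_nonneg (by positivity)]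
    omega
  have := Nat.le_of_dvd (Int.natAbs_pos.mpr hne) (Int.natAbs_dvd_natAbs.mpr hdvd)
  omega

/-- Radical bound: `rad(a₁ ⋯ aₙ) ≤ K x⁴` at `x = b₀^e`, `b₀ > 0`. [cite: HolzlKleineStephan2025, proof of Theorem 13] -/
theorem radical_le (h : HKSData m x y v w q) {b₀ : ℤ} {e : ℕ} (hx : x = b₀ ^ e) (hb : 0 < b₀) :
    (radical (∏ i, hksTuple m x y v w q i) : ℤ) ≤ kConst m y v w b₀ q * x ^ 4 := by
  rw [prod_hksTuple]
  have hD : 0 < dBase m x y v w b₀ q := by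
    have h1 : 0 < x + y := by linarith [h.x_gt, h.v_pos, h.y_pos]
    have h2 : 0 < x - y := by linarith [h.x_gt, h.v_pos]
    have h3 : 0 < (10 * y - 1) * b₀ := mul_pos (by linarith [h.y_pos]) hb
    have h4 : 0 < x ^ 2 + 10 * y ^ 3 := by have := pow_pos h.y_pos 3; positivity
    have h5 : 0 < v * -w := mul_pos h.v_pos (by linarith [h.w_neg])
    have h6 : 0 < ∏ j, q j := Finset.prod_pos fun j _ => h.q_pos j
    unfold dBase; positivity
  exact (Int.le_of_dvd hD (h.radical_dvd_dBase hx)).trans (h.dBase_le hb)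

end HKSData

/-! ### Step 7: the limit `5t log b / (log K + 4t log b) → 5/4` -/

/-- If a family `fam t` of tuples has size `≥ b^{5t}` and radical in `(1, K·b^{4t}]` (`b > 1`,
`K ≥ 1`), then for every `θ < 5/4` its quality eventually exceeds `θ`. [folklore] -/
theorem nQuality_eventually_gt_five_fourths {n : ℕ} {b K θ : ℝ} (hb : 1 < b) (hK : 1 ≤ K)
    (hθ : θ < 5 / 4) (fam : ℕ → (Fin n → ℤ))
    (hM : ∀ t : ℕ, b ^ (5 * t) ≤ (tupleMax (fam t) : ℝ))
    (hR1 : ∀ t : ℕ, (1 : ℝ) < ((radical (∏ i, fam t i) : ℤ) : ℝ))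
    (hRle : ∀ t : ℕ, ((radical (∏ i, fam t i) : ℤ) : ℝ) ≤ K * b ^ (4 * t)) :
    ∃ t₀ : ℕ, ∀ t : ℕ, t₀ ≤ t → θ < nQuality (fam t) := by
  have hlogb : 0 < Real.log b := Real.log_pos hb
  have hlogK : 0 ≤ Real.log K := Real.log_nonneg hK
  obtain ⟨t₀, ht₀⟩ := exists_nat_gt (max θ 0 * Real.log K / ((5 - 4 * θ) * Real.log b))
  refine ⟨t₀ + 1, fun t ht => ?_⟩
  have hR1' := hR1 t
  have hRle' := hRle t
  have hM' := hM t
  set R : ℝ := ((radical (∏ i, fam t i) : ℤ) : ℝ) with hRdef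
  set M : ℝ := (tupleMax (fam t) : ℝ) with hMdef
  have hlogR : 0 < Real.log R := Real.log_pos hR1'
  have hK0 : 0 < K := by linarith
  have hb0 : 0 < b := by linarith
  have hlogRle : Real.log R ≤ Real.log K + 4 * t * Real.log b := by
    calc Real.log R ≤ Real.log (K * b ^ (4 * t)) := Real.log_le_log (by linarith) hRle'
      _ = Real.log K + 4 * t * Real.log b := by
          rw [Real.log_mul (by positivity) (by positivity), Real.log_pow]; push_cast; ring
  have hMpos : (0 : ℝ) < b ^ (5 * t) := by positivity
  have hlogM : 5 * t * Real.log b ≤ Real.log M := by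
    calc (5 : ℝ) * t * Real.log b = Real.log (b ^ (5 * t)) := by
          rw [Real.log_pow]; push_cast; ring
      _ ≤ Real.log M := Real.log_le_log hMpos hM'
  change θ < Real.log M / Real.log R
  rw [lt_div_iff₀ hlogR]
  have hme : (0 : ℝ) ≤ 5 * t * Real.log b := by positivity
  rcases lt_or_ge θ 0 with hθ0 | hθ0
  · calc θ * Real.log R < 0 := mul_neg_of_neg_of_pos hθ0 hlogR
      _ ≤ 5 * t * Real.log b := hme
      _ ≤ Real.log M := hlogM
  · have hmax : max θ 0 = θ := max_eq_left hθ0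
    rw [hmax] at ht₀
    have h3 : 0 < (5 - 4 * θ) * Real.log b := mul_pos (by linarith) hlogb
    have ht' : θ * Real.log K / ((5 - 4 * θ) * Real.log b) < t := by
      calc _ < (t₀ : ℝ) := ht₀
        _ ≤ t := by exact_mod_cast (by omega : t₀ ≤ t)
    rw [div_lt_iff₀ h3] at ht'
    calc θ * Real.log R ≤ θ * (Real.log K + 4 * t * Real.log b) :=
          mul_le_mul_of_nonneg_left hlogRle hθ0
      _ < 5 * t * Real.log b := by nlinarith
      _ ≤ Real.log M := hlogM

/-! ### Step 8: Theorem 13 (`y = 330`, `x = 331^{φ(L)(t+T₀)}`) -/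

/-- **Hölzl–Kleine–Stephan (2025), Theorem 13 — discharged.** For every `n ≥ 6` and every `θ < 5/4`
there are infinitely many pairwise coprime admissible `n`-term sums of quality `> θ`
(`Q_{R(n)} ≥ 5/4`). The witnesses are the tuples of the proof of Theorem 13 with `F = ∅`, `y = 330`
(so that `3, 11 ∣ y`, `2 ∣ y`, `101 ∤ 10y − 1`), `x = 331^{φ(L)·(t + T₀)}` (Euler's theorem replaces
`x = (y+1)^{h!}` and Fermat), the fillers `a₇, …, aₙ` produced by the Euclid trick instead of large
primes, and `a₅, a₆` from the splitting lemma `exists_odd_forall_not_dvd` instead of Lemma 15.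
[cite: HolzlKleineStephan2025, Theorem 13] -/
theorem PairwiseQualityFloor_holds : PairwiseQualityFloor := by
  intro n hn θ hθ
  obtain ⟨m, rfl⟩ : ∃ m, n = m + 6 := ⟨n - 6, by omega⟩
  -- (A) the constants `v, w, q`
  have hB : (0 : ℤ) < (330 + 1) * (330 - 1) * (10 * 330 - 1) * (10 * 330 ^ 3 + 1) := by norm_num
  have hBodd : Odd ((330 + 1) * (330 - 1) * (10 * 330 - 1) * (10 * 330 ^ 3 + 1) : ℤ) := by
    rw [Int.odd_iff]; norm_num
  have hc : (0 : ℤ) < 100 * 330 ^ 6 - 2 * 330 ^ 5 := by norm_num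
  obtain ⟨v, w, q, hv, hw, -, hq3, -, hvw, cvw, cvB, cwB, cqB, cvq, cwq, cqq⟩ :=
    exists_constants hB hBodd hc m
  have hq0 : ∀ j, 0 < q j := fun j => by linarith [hq3 j]
  -- (B) the modulus `L` and the base `bN = 331^{φ(L)}`
  set P : ℤ := (10 * 330 - 1) * (10 * 330 + 1) * v * w * ∏ j, q j with hP
  have hP0 : P ≠ 0 := by
    have h1 : (∏ j, q j) ≠ 0 := Finset.prod_ne_zero_iff.mpr fun j _ => (hq0 j).ne'
    have h2 : (10 * 330 - 1 : ℤ) ≠ 0 := by norm_num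
    have h3 : (10 * 330 + 1 : ℤ) ≠ 0 := by norm_num
    rw [hP]
    exact mul_ne_zero (mul_ne_zero (mul_ne_zero (mul_ne_zero h2 h3) hv.ne') hw.ne) h1
  set L : ℕ := P.natAbs with hL
  have hLpos : 0 < L := Int.natAbs_pos.mpr hP0
  have h331 : ∀ z : ℤ, IsCoprime z ((330 + 1) * (330 - 1) * (10 * 330 - 1) * (10 * 330 ^ 3 + 1)) →
      IsCoprime (331 : ℤ) z := fun z hz => by
    have h' : IsCoprime z (330 + 1) := hz.of_mul_right_left.of_mul_right_left.of_mul_right_left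
    norm_num at h'
    exact h'.symm
  have hcopP : IsCoprime (331 : ℤ) P := by
    have h1 : IsCoprime (331 : ℤ) (10 * 330 - 1) := by norm_num [Int.isCoprime_iff_gcd_eq_one]
    have h2 : IsCoprime (331 : ℤ) (10 * 330 + 1) := by norm_num [Int.isCoprime_iff_gcd_eq_one]
    rw [hP]
    exact (((h1.mul_right h2).mul_right (h331 v cvB)).mul_right (h331 w cwB)).mul_right
      (IsCoprime.prod_right fun j _ => h331 _ (cqB j))
  have hcopN : Nat.Coprime 331 L := by
    have h1 := Int.isCoprime_iff_gcd_eq_one.mp hcopP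
    rw [Int.gcd_eq_natAbs] at h1
    exact h1
  have hφ : 0 < Nat.totient L := Nat.totient_pos.mpr hLpos
  set bN : ℕ := 331 ^ Nat.totient L with hbN
  have hbN1 : 1 < bN := Nat.one_lt_pow hφ.ne' (by norm_num)
  have hbNpos : (0 : ℤ) < bN := by exact_mod_cast Nat.zero_lt_of_lt hbN1
  have hLdvd : (L : ℤ) ∣ (bN : ℤ) - 1 := by
    have h1 : 1 ≤ 331 ^ Nat.totient L := Nat.one_le_pow _ _ (by norm_num)
    have h2 : L ∣ 331 ^ Nat.totient L - 1 :=
      (Nat.modEq_iff_dvd' h1).mp (Nat.ModEq.pow_totient hcopN).symm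
    have h3 := Int.natCast_dvd_natCast.mpr h2
    rw [Nat.cast_sub h1, Nat.cast_one] at h3
    exact h3
  have hzP : ∀ z : ℤ, z ∣ P → ∀ t : ℕ, z ∣ (bN : ℤ) ^ t - 1 := fun z hz t => by
    have h1 : z ∣ (L : ℤ) := by rw [hL, Int.natCast_natAbs]; exact (dvd_abs _ _).mpr hz
    exact h1.trans (hLdvd.trans (sub_one_dvd_pow_sub_one _ _))
  have hd1 : (10 * 330 - 1 : ℤ) ∣ P := by
    rw [hP]; exact (((dvd_mul_right _ _).mul_right v).mul_right w).mul_right _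
  have hd2 : (10 * 330 + 1 : ℤ) ∣ P := by
    rw [hP]; exact (((dvd_mul_left _ _).mul_right v).mul_right w).mul_right _
  have hdv : v ∣ P := by rw [hP]; exact ((dvd_mul_left v _).mul_right w).mul_right _
  have hdw : w ∣ P := by rw [hP]; exact (dvd_mul_left w _).mul_right _
  have hdq : ∀ j, q j ∣ P := fun j => by
    rw [hP]; exact (Finset.dvd_prod_of_mem q (Finset.mem_univ j)).mul_left _
  -- (C) the shift `T₀` and the standing hypotheses at `x = bN^(t+T₀)`
  set T₀ : ℕ := (v + 330).toNat + 1 with hT₀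
  have hxgt : ∀ t : ℕ, v + 330 < (bN : ℤ) ^ (t + T₀) := fun t => by
    have h1 : t + T₀ < bN ^ (t + T₀) := Nat.lt_pow_self hbN1
    have h2 : ((t + T₀ : ℕ) : ℤ) < ((bN ^ (t + T₀) : ℕ) : ℤ) := by exact_mod_cast h1
    have h3 : v + 330 ≤ ((v + 330).toNat : ℤ) := Int.self_le_toNat _
    push_cast at h2
    have h4 : (T₀ : ℤ) = ((v + 330).toNat : ℤ) + 1 := by rw [hT₀]; push_cast; ring
    linarith
  have hx331 : ∀ t : ℕ, (bN : ℤ) ^ (t + T₀) = (331 : ℤ) ^ (Nat.totient L * (t + T₀)) := fun t => by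
    rw [hbN]; push_cast; ring
  have hdata : ∀ t : ℕ, HKSData m ((bN : ℤ) ^ (t + T₀)) 330 v w q := fun t =>
    { y_pos := by norm_num
      x_gt := hxgt t
      v_pos := hv
      w_neg := hw
      q_pos := hq0
      vw := hvw
      cop_xy := by
        rw [hx331]
        exact (show IsCoprime (331 : ℤ) 330 from ⟨1, -1, by norm_num⟩).pow_left
      cop_x10 := by
        rw [hx331]
        exact (show IsCoprime (331 : ℤ) 10 by norm_num [Int.isCoprime_iff_gcd_eq_one]).pow_left
      odd := by
        refine Odd.add_even ?_ ⟨165, by norm_num⟩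
        rw [hx331]
        exact Odd.pow ⟨165, by norm_num⟩
      dvd₁ := hzP _ hd1 _
      dvd₂ := hzP _ hd2 _
      dvd_v := hzP _ hdv _
      dvd_w := hzP _ hdw _
      dvd_q := fun j => hzP _ (hdq j) _
      Y₁ := by norm_num [Int.isCoprime_iff_gcd_eq_one]
      Y₂ := by norm_num [Int.isCoprime_iff_gcd_eq_one]
      Y₃ := by norm_num [Int.isCoprime_iff_gcd_eq_one]
      Y₄ := by norm_num [Int.isCoprime_iff_gcd_eq_one]
      Y₅ := by norm_num [Int.isCoprime_iff_gcd_eq_one]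
      cop_vB := cvB
      cop_wB := cwB
      cop_qB := cqB
      cop_vw := cvw
      cop_vq := cvq
      cop_wq := cwq
      cop_qq := cqq }
  -- (D) the family, its size and its radical
  set fam : ℕ → (Fin (m + 6) → ℤ) := fun t => HKSData.hksTuple m ((bN : ℤ) ^ (t + T₀)) 330 v w q
    with hfam
  set K : ℤ := HKSData.kConst m 330 v w (bN : ℤ) q with hK
  have hKpos : 0 < K := (hdata 0).kConst_pos hbNpos
  have hM : ∀ t : ℕ, (bN : ℝ) ^ (5 * t) ≤ (tupleMax (fam t) : ℝ) := fun t => by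
    have h1 := (hdata t).pow_five_le_tupleMax
    have h2 : (bN : ℤ) ^ (5 * t) ≤ ((bN : ℤ) ^ (t + T₀)) ^ 5 := by
      rw [← pow_mul]
      exact pow_le_pow_right₀ (by exact_mod_cast hbN1.le) (by nlinarith)
    have h3 : (bN : ℤ) ^ (5 * t) ≤ (tupleMax (fam t) : ℤ) := h2.trans h1
    exact_mod_cast h3
  have hR1 : ∀ t : ℕ, (1 : ℝ) < ((radical (∏ i, fam t i) : ℤ) : ℝ) := fun t => by
    exact_mod_cast (hdata t).one_lt_radical
  have hRle : ∀ t : ℕ, ((radical (∏ i, fam t i) : ℤ) : ℝ) ≤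
      ((K * (bN : ℤ) ^ (4 * T₀) : ℤ) : ℝ) * (bN : ℝ) ^ (4 * t) := fun t => by
    have h1 := (hdata t).radical_le rfl hbNpos
    have h3 : (radical (∏ i, fam t i) : ℤ) ≤ (K * (bN : ℤ) ^ (4 * T₀)) * (bN : ℤ) ^ (4 * t) := by
      calc _ ≤ _ := h1
        _ = _ := by rw [hK]; ring
    exact_mod_cast h3
  have hb1 : (1 : ℝ) < (bN : ℝ) := by exact_mod_cast hbN1
  have hK1 : (1 : ℝ) ≤ ((K * (bN : ℤ) ^ (4 * T₀) : ℤ) : ℝ) := by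
    have : (1 : ℤ) ≤ K * (bN : ℤ) ^ (4 * T₀) := by
      have h1 : (1 : ℤ) ≤ K := hKpos
      have h2 : (1 : ℤ) ≤ (bN : ℤ) ^ (4 * T₀) := one_le_pow₀ (by exact_mod_cast hbN1.le)
      nlinarith
    exact_mod_cast this
  obtain ⟨t₀, ht₀⟩ := nQuality_eventually_gt_five_fourths hb1 hK1 hθ fam hM hR1 hRle
  -- (E) infinitely many witnesses
  have hinj : Function.Injective fun t : ℕ => fam (t + t₀) := by
    intro t t' he
    have h1 := congr_fun he (finSumFinEquiv (Sum.inr 0))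
    simp only [hfam] at h1
    rw [HKSData.hksTuple_apply, HKSData.hksTuple_apply] at h1
    change ((bN : ℤ) ^ (t + t₀ + T₀) + 330) ^ 5 = ((bN : ℤ) ^ (t' + t₀ + T₀) + 330) ^ 5 at h1
    have h2 := (pow_left_inj₀ (by positivity) (by positivity) (by norm_num : (5 : ℕ) ≠ 0)).mp h1
    have h3 : ((bN ^ (t + t₀ + T₀) : ℕ) : ℤ) = ((bN ^ (t' + t₀ + T₀) : ℕ) : ℤ) := by
      push_cast; linarith
    have h4 := Nat.pow_right_injective hbN1 (Nat.cast_injective h3)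
    omega
  refine Set.infinite_of_injective_forall_mem hinj fun t => ?_
  exact ⟨(hdata _).isAdmissibleSum, (hdata _).pairwise_tuple, ht₀ _ (by omega)⟩

end Literature.Barriers.ABC

end
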